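import Literature.MathematicalPhysics.QuantumManyBody.BoseGasSubcellCondensationSharp
import HarnessLib

/-!
# `BlockCondensation` (stmt-AtomisticToContinuum-13595), P3 bookkeeping: the floor budget under a
# proportional slack `(4πa + τ)ρN` (decomp-a2c · hand-1 g9)

The tree's `floorBudget_le_of_le` (`BoseGasSubcellCondensationSharp.lean`) bounds the budget
`2Cs²(U + B − A) + CwU` of the deterministic floor inequality by `ηN` for the DIRICHLET energy
budget `U = 4πρa(1 + C_u(ρa³)^{1/3})N + 1`; the absolute `+1` is what produces the particle
threshold `2(8CM²/ρ + Cw̄) ≤ ηN` there.  The boundary-condition-free leaf F♭ of the carving of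
`BlockCondensation` (lens-6 g27/g28, memo `CARRIER-CHANGE-13595-P1.md` §3) works instead with the
PROPORTIONAL budget `U = (4πa + τ)ρN`: this file proves the corresponding bound
`floorBudget_le_of_slack` — the same term-by-term estimate with the `+1` terms gone and the slack
`τ` entering as `8CM²·τ` per particle (from `2Cs²·τρN`, `s² ≤ 4M²/ρ`) and through `τ ≤ 4πa` in the
excluded-volume term — so that NO particle threshold is needed (box-uniformity of F♭).
Pure real arithmetic; no definitions, no `sorry`.
-/

noncomputable section

namespace Summit.AtomisticToContinuum.BoseEinsteinCondensation.Theorems.BlockCondensationFloorPos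

open Literature.MathematicalPhysics.QuantumManyBody.BoseGas
set_option maxHeartbeats 400000 in
/-- **The budget of the floor inequality under the proportional slack.**  With
`U = (4πa + τ)ρN`, `A = (1-θ)(4πa/s³)N²/K`, `B = K·lam·((1-θ)(8πa/s³)(N/K) + 1/(2Cs²))`,
`N/K = ρs³` and `M/√ρ ≤ s ≤ 2M/√ρ`, the quantity `2Cs²(U + B - A) + CwU` is at most `ηN` as soon
as `τ ≤ 4πa` and `8CM²τ + (32πCM²a·θ̄ + 16πCa·λ̄√ρ/M + λ̄√ρ/M³ + 8πCaρw̄) ≤ η` — no threshold in `N`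
(the tree's `floorBudget_le_of_le` with the absolute `+1` replaced by the slack `τρN`).
[cite: LSSY2005, proof of Thm. 5.1 (5.15)–(5.17)] -/
theorem floorBudget_le_of_slack {a C τ M ρ s lam lambar w wbar θ θbar N K η : ℝ} (hM : 0 < M)
    (ha : 0 < a) (hC : 0 < C) (hτ0 : 0 ≤ τ) (hτ : τ ≤ 4 * Real.pi * a) (hρ : 0 < ρ)
    (hsl : M / Real.sqrt ρ ≤ s) (hsu : s ≤ 2 * M / Real.sqrt ρ) (hθ0 : 0 ≤ θ) (hθ : θ ≤ θbar)
    (hlam0 : 0 ≤ lam) (hlam : lam ≤ lambar) (hw0 : 0 ≤ w) (hw : w ≤ wbar) (hN0 : 0 ≤ N)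
    (hK : 0 < K) (hKN : N / K = ρ * s ^ 3)
    (hpar : 8 * C * M ^ 2 * τ + (32 * Real.pi * C * M ^ 2 * a * θbar +
      16 * Real.pi * C * a * lambar * Real.sqrt ρ / M + lambar * Real.sqrt ρ / M ^ 3 +
        8 * Real.pi * C * a * ρ * wbar) ≤ η) :
    2 * C * s ^ 2 * ((4 * Real.pi * a + τ) * ρ * N +
        K * lam * ((1 - θ) * (8 * Real.pi * a / s ^ 3) * (N / K) + 1 / (2 * C * s ^ 2)) -
          (1 - θ) * (4 * Real.pi * a / s ^ 3) * N ^ 2 / K) +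
      C * w * ((4 * Real.pi * a + τ) * ρ * N) ≤ η * N := by
  have hsr : 0 < Real.sqrt ρ := Real.sqrt_pos.2 hρ
  have hs : 0 < s := lt_of_lt_of_le (by positivity) hsl
  -- `K = N/(ρ s³)` bookkeeping
  have hKeq : K * (ρ * s ^ 3) = N := by
    field_simp at hKN; linarith [hKN]
  have hA : (1 - θ) * (4 * Real.pi * a / s ^ 3) * N ^ 2 / K = (1 - θ) * 4 * Real.pi * a * ρ * N := by
    have h1 : N ^ 2 / K = N * (N / K) := by rw [pow_two, mul_div_assoc]
    rw [mul_div_assoc, h1, hKN]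
    field_simp
  have hB : K * lam * ((1 - θ) * (8 * Real.pi * a / s ^ 3) * (N / K) + 1 / (2 * C * s ^ 2)) =
      N * lam * ((1 - θ) * 8 * Real.pi * a) / s ^ 3 + N * lam / (2 * C * ρ * s ^ 5) := by
    have hKinv : K = N / (ρ * s ^ 3) := by field_simp; linarith [hKeq]
    rw [hKN, hKinv]
    field_simp
  -- the scale bounds
  have hlb : 0 ≤ lambar := hlam0.trans hlam
  have hwbar : 0 ≤ wbar := hw0.trans hw
  have hs2 := sq_le_of_scale hρ hsu hs
  have hs1 := inv_le_of_scale hM hρ hsl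
  have hs3 := inv_cube_le_of_scale hM hρ hsl
  have hρs : ρ * s ^ 2 ≤ 4 * M ^ 2 := by
    have := mul_le_mul_of_nonneg_left hs2 hρ.le
    rwa [mul_div_cancel₀ _ hρ.ne'] at this
  -- term by term
  have hT1 : 2 * C * s ^ 2 * ((4 * Real.pi * a + τ) * ρ * N - (1 - θ) * 4 * Real.pi * a * ρ * N) ≤
      N * (8 * C * M ^ 2 * τ + 32 * Real.pi * C * M ^ 2 * a * θbar) := by
    have h1 : (4 * Real.pi * a + τ) * ρ * N - (1 - θ) * 4 * Real.pi * a * ρ * N =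
        N * (τ + 4 * Real.pi * a * θ) * ρ := by ring
    rw [h1]
    have h2 : 2 * C * s ^ 2 * (N * (τ + 4 * Real.pi * a * θ) * ρ) =
        2 * C * N * (τ + 4 * Real.pi * a * θ) * (ρ * s ^ 2) := by ring
    rw [h2]
    have h3 : τ + 4 * Real.pi * a * θ ≤ τ + 4 * Real.pi * a * θbar := by nlinarith [Real.pi_pos]
    have hθb : 0 ≤ τ + 4 * Real.pi * a * θbar := le_trans (by positivity) h3
    calc 2 * C * N * (τ + 4 * Real.pi * a * θ) * (ρ * s ^ 2)
        ≤ 2 * C * N * (τ + 4 * Real.pi * a * θbar) * (4 * M ^ 2) := by gcongr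
      _ = N * (8 * C * M ^ 2 * τ + 32 * Real.pi * C * M ^ 2 * a * θbar) := by ring
  have hT3 : 2 * C * s ^ 2 * (N * lam * ((1 - θ) * 8 * Real.pi * a) / s ^ 3) ≤
      N * (16 * Real.pi * C * a * lambar * Real.sqrt ρ / M) := by
    have h1 : 2 * C * s ^ 2 * (N * lam * ((1 - θ) * 8 * Real.pi * a) / s ^ 3) =
        16 * Real.pi * C * a * N * ((1 - θ) * lam) * (1 / s) := by
      field_simp
      ring
    rw [h1]
    have h2 : (1 - θ) * lam ≤ lambar := by nlinarith
    calc 16 * Real.pi * C * a * N * ((1 - θ) * lam) * (1 / s)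
        ≤ 16 * Real.pi * C * a * N * lambar * (Real.sqrt ρ / M) := by
          gcongr
      _ = N * (16 * Real.pi * C * a * lambar * Real.sqrt ρ / M) := by ring
  have hT4 : 2 * C * s ^ 2 * (N * lam / (2 * C * ρ * s ^ 5)) ≤ N * (lambar * Real.sqrt ρ / M ^ 3) := by
    have h1 : 2 * C * s ^ 2 * (N * lam / (2 * C * ρ * s ^ 5)) = N * lam / ρ * (1 / s ^ 3) := by
      field_simp
    rw [h1]
    calc N * lam / ρ * (1 / s ^ 3) ≤ N * lambar / ρ * (ρ * Real.sqrt ρ / M ^ 3) := by gcongr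
      _ = N * (lambar * Real.sqrt ρ / M ^ 3) := by field_simp
  have hT5 : C * w * ((4 * Real.pi * a + τ) * ρ * N) ≤ N * (8 * Real.pi * C * a * ρ * wbar) := by
    have h1 : 4 * Real.pi * a + τ ≤ 8 * Real.pi * a := by linarith
    calc C * w * ((4 * Real.pi * a + τ) * ρ * N)
        ≤ C * wbar * ((8 * Real.pi * a) * ρ * N) := by gcongr
      _ = N * (8 * Real.pi * C * a * ρ * wbar) := by ring
  -- assemble
  have htot : N * (8 * C * M ^ 2 * τ + 32 * Real.pi * C * M ^ 2 * a * θbar) +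
      N * (16 * Real.pi * C * a * lambar * Real.sqrt ρ / M) + N * (lambar * Real.sqrt ρ / M ^ 3) +
      N * (8 * Real.pi * C * a * ρ * wbar) ≤ η * N := by
    calc N * (8 * C * M ^ 2 * τ + 32 * Real.pi * C * M ^ 2 * a * θbar) +
          N * (16 * Real.pi * C * a * lambar * Real.sqrt ρ / M) + N * (lambar * Real.sqrt ρ / M ^ 3) +
          N * (8 * Real.pi * C * a * ρ * wbar)
        = N * (8 * C * M ^ 2 * τ + (32 * Real.pi * C * M ^ 2 * a * θbar +
            16 * Real.pi * C * a * lambar * Real.sqrt ρ / M + lambar * Real.sqrt ρ / M ^ 3 +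
            8 * Real.pi * C * a * ρ * wbar)) := by ring
      _ ≤ N * η := mul_le_mul_of_nonneg_left hpar hN0
      _ = η * N := mul_comm _ _
  calc _ = 2 * C * s ^ 2 * ((4 * Real.pi * a + τ) * ρ * N - (1 - θ) * 4 * Real.pi * a * ρ * N) +
        2 * C * s ^ 2 * (N * lam * ((1 - θ) * 8 * Real.pi * a) / s ^ 3) +
        2 * C * s ^ 2 * (N * lam / (2 * C * ρ * s ^ 5)) +
        C * w * ((4 * Real.pi * a + τ) * ρ * N) := by rw [hA, hB]; ring
    _ ≤ _ := by linarith [hT1, hT3, hT4, hT5, htot]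

end Summit.AtomisticToContinuum.BoseEinsteinCondensation.Theorems.BlockCondensationFloorPos

end
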